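import Summits.Ventures.HSemireg.ComponentTransfer
import Summits.Ventures.HSemireg.SemiregularityTheorems
import HarnessLib

/-!
# Venture HSemireg — the transfer chain with a SHEAF representative: a Buchweitz–Flenner `I`-semiregular vector
# bundle at ONE point of the chart makes the class algebraic on the whole swept component (BF 2003, Thm. 5.1)

HONEST FRAMING. Companion of `ComponentTransfer.lean` (theory seat 3 of the cell `pub-hsemireg`); THEOREMS ONLY, no new
definition, nothing asserted about any variety, no claim that HC / HC_CM holds. `ComponentTransfer.lean` composes the chain
for a Bloch-semiregular local complete intersection (the CYCLE door, Bloch 1972 (7.4)). Buchweitz–Flenner's Thm. 5.1 is the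
SHEAF door: «Let `π : X → S` be a deformation of a compact complex algebraic manifold `X₀` over a smooth germ `S = (S,0)` […].
Assume that `(α_p)_{p∈I}` is a horizontal section in `∏_{p∈I} Rᵖπ_*(Ωᵖ_{X/S})`. If there is an `I`-semiregular sheaf `ℰ₀` on
`X₀` with `α_p(0) = ch_p(ℰ₀)`, `p ∈ I`, then `α_p(s)` is algebraic for all `s ∈ S` near `0` and each `p ∈ I`» (p. 174 L56 –
p. 175 L4) — in the tree the refereed named fact `BuchweitzFlenner2003_variationalHodge_ISemiregular` (finite locally free
`ℰ₀`, Chern degrees `I` ↔ form degrees `{q | q + 1 ∈ I}` of the real partial semiregularity map `IsISemiregular`), made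
GLOBAL along an irreducible smooth quasi-projective base by theory seat 1's theorem
`BuchweitzFlenner2003.semiregular_deforms` (`SemiregularityTheorems.lean`; inputs `hBF` and the tree's PROVED
algebraicity-locus fact). This file only SWEEPS that conclusion onto a component of the locus of Hodge classes:

* `hc_on_component_of_semiregular_sheaf` — chart `(f, W p)` sweeping `C.carrier`, a finite locally free `I`-semiregular
  `ℰ₀` on the chart fibre `𝒳_{u₀}` with `W_{p'}|_{𝒳_{u₀}} = ch_{p'}(ℰ₀)` for every `p' ∈ I` (each `W_{p'}` a global class
  of Hodge type `(p',p')` on every fibre — BF's horizontality), `p ∈ I` ⟹ every class of `C` is algebraic.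
* `hc_on_component_of_semiregular_sheaf_of_smul_add` — the `q·hⁿ + w` shape: the swept class is `V` with
  `W_p = a • V + b • L`, `a, b ∈ ℚ`, `a ≠ 0`, `L` fibrewise algebraic (Markman's secant sheaves: `ch_n = q·hⁿ + w`).
* chart forms `forall_mem_algebraicClasses_of_sweepsClasses_sheaf(_of_smul_add)` (conclusion on any swept set `A`).

SCOPE (as printed vs as typed): `ℰ₀` FINITE LOCALLY FREE and untwisted (BF print «coherent»; reflexive / twisted / perfect-
complex representatives — the cell's T4a object — have NO door here: theory seat 1, `TH1-PERFECT-COMPLEX.md`); `I` a finite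
set of Chern degrees; the other Chern classes `ch_{p'}(ℰ₀)`, `p' ∈ I ∖ {p}`, must ALSO be met by global fibrewise-`(p',p')`
classes (on a Weil-type component whose generic Néron–Severi group is `ℚ·h` this forces `ch_{p'} ∝ h^{p'}`). Inputs BY
NAME: `hBF : BuchweitzFlenner2003_variationalHodge_ISemiregular`; `SweepsClasses` (hypothesis, the CDK chart);
`charlesSchnell_algebraicityLocus_iUnion_closed` (discharged in the tree). NOT inputs: CM-ness, HC_CM, CM density, MT
finiteness.

References: [BuchweitzFlenner2003] Compositio Math. 137 (2003), §5 Thm. 5.1 pp. 174–175, Def. 4.1 p. 166;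
[Bloch1972Semiregularity] proof of (7.4), p. 65 (globalisation); [CattaniDeligneKaplan1995JAMS] Thm. 1.1, Cor. 1.2;
[Markman2025SecantWeil] arXiv:2502.03415 §1.5 (the shape `q·hⁿ + w`).
-/

noncomputable section

open CategoryTheory AlgebraicGeometry Set
open Literature.AlgebraicGeometry.Motives Literature.AlgebraicGeometry.HodgeTheory
open Literature.AlgebraicTopology.SingularHomology

namespace Summit.Ventures.HSemireg

local notation3 (prettyPrint := false) "Res[" f ", " s ", " k ", " A "]" =>
  complexBetti.map (Literature.AlgebraicGeometry.Motives.fiberι f s) k A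

section Sheaf

variable {𝒴 M : SchemeOver ℂ} {g : 𝒴 ⟶ M} {𝒳 T : SchemeOver ℂ} {f : 𝒳 ⟶ T} {n p : ℕ}

/-- **Transfer along a chart, sheaf representative (BF 2003 Thm. 5.1 global ∘ CDK chart).** Let the chart `f : 𝒳 ⟶ T`
(smooth projective of relative dimension `n`; `𝒳`, `T` quasi-projective; `T` smooth irreducible) carry global classes
`W_{p'} ∈ H^{2p'}(𝒳(ℂ); ℂ)`, `p' ∈ I`, of Hodge type `(p',p')` on every fibre, and at ONE point `u₀` a finite locally free
`I`-semiregular `ℰ₀` on `𝒳_{u₀}` with `W_{p'}|_{𝒳_{u₀}} = ch_{p'}(ℰ₀)` for all `p' ∈ I`. If `(f, W_p)` sweeps a set `A` of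
fibre classes of `g` (`p ∈ I`), then every class in `A` is algebraic: `BuchweitzFlenner2003.semiregular_deforms` makes
`W_p` algebraic on every fibre of the chart; sweep. [cite: BuchweitzFlenner2003, §5 Thm. 5.1, pp. 174–175]
[cite: Bloch1972Semiregularity, proof of Thm. (7.4), p. 65] [cite: CattaniDeligneKaplan1995JAMS, Thm. 1.1 and Cor. 1.2] -/
theorem forall_mem_algebraicClasses_of_sweepsClasses_sheaf (hBF : BuchweitzFlenner2003_variationalHodge_ISemiregular)
    (Cc : ChernCharacterBetti)
    (hf : IsSmoothProjectiveFamily f n) (h𝒳 : IsQuasiProjectiveOver 𝒳) (hT : IsQuasiProjectiveOver T)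
    (hTs : _root_.AlgebraicGeometry.Smooth T.hom) [IrreducibleSpace T.left]
    (u₀ : ComplexPoints T) (E₀ : (fiberOver f u₀).left.Modules) (hE₀ : IsFiniteLocallyFree E₀) (I : Finset ℕ)
    (hsr : IsISemiregular hE₀ {q | q + 1 ∈ I})
    (W : (p' : ℕ) → complexBetti 𝒳 (2 * p'))
    (hW : ∀ p' ∈ I, ∀ u : ComplexPoints T,
      IsOfHodgeType n (fiberOver f u) (2 * p') p' p' (Res[f, u, 2 * p', W p']))
    (hW₀ : ∀ p' ∈ I, Res[f, u₀, 2 * p', W p'] = Cc.ch (fiberOver f u₀) E₀ p')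
    (hp : p ∈ I) {A : Set (FiberClass g (2 * p))} (hsweep : SweepsClasses g f (W p) A) :
    ∀ x ∈ A, x.cls ∈ algebraicClasses (fiberOver g x.pt) p :=
  fun _ hx => hsweep.mem_algebraicClasses
    (fun u => BuchweitzFlenner2003.semiregular_deforms hBF charlesSchnell_algebraicityLocus_iUnion_closed_holds Cc f
      hf h𝒳 hT hTs u₀ E₀ hE₀ I hsr W hW hW₀ hp u) hx

/-- **Transfer along a chart, sheaf representative, `q·hⁿ + w` shape.** As
`forall_mem_algebraicClasses_of_sweepsClasses_sheaf`, but the swept class is `V` with `W_p = a • V + b • L` for rationals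
`a ≠ 0`, `b` and a global class `L` that is algebraic on every fibre (for the cell: `V ↦ w` the Weil class, `L ↦ hⁿ`,
`ch_n(ℰ₀) = q·hⁿ + w`): every class of the swept set is algebraic (`V|_u = a⁻¹ • (W_p|_u - b • L|_u)` lies in the
`ℂ`-subspace of algebraic classes). [cite: BuchweitzFlenner2003, §5 Thm. 5.1, pp. 174–175]
[cite: Markman2025SecantWeil, §1.5] -/
theorem forall_mem_algebraicClasses_of_sweepsClasses_sheaf_of_smul_add
    (hBF : BuchweitzFlenner2003_variationalHodge_ISemiregular) (Cc : ChernCharacterBetti)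
    (hf : IsSmoothProjectiveFamily f n) (h𝒳 : IsQuasiProjectiveOver 𝒳) (hT : IsQuasiProjectiveOver T)
    (hTs : _root_.AlgebraicGeometry.Smooth T.hom) [IrreducibleSpace T.left]
    (u₀ : ComplexPoints T) (E₀ : (fiberOver f u₀).left.Modules) (hE₀ : IsFiniteLocallyFree E₀) (I : Finset ℕ)
    (hsr : IsISemiregular hE₀ {q | q + 1 ∈ I})
    (W : (p' : ℕ) → complexBetti 𝒳 (2 * p'))
    (hW : ∀ p' ∈ I, ∀ u : ComplexPoints T,
      IsOfHodgeType n (fiberOver f u) (2 * p') p' p' (Res[f, u, 2 * p', W p']))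
    (hW₀ : ∀ p' ∈ I, Res[f, u₀, 2 * p', W p'] = Cc.ch (fiberOver f u₀) E₀ p')
    (hp : p ∈ I) (V L : complexBetti 𝒳 (2 * p)) (a b : ℚ) (ha : a ≠ 0)
    (hVL : W p = (a : ℂ) • V + (b : ℂ) • L)
    (hLalg : ∀ u : ComplexPoints T, Res[f, u, 2 * p, L] ∈ algebraicClasses (fiberOver f u) p)
    {A : Set (FiberClass g (2 * p))} (hsweep : SweepsClasses g f V A) :
    ∀ x ∈ A, x.cls ∈ algebraicClasses (fiberOver g x.pt) p := by
  have ha' : (a : ℂ) ≠ 0 := by exact_mod_cast ha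
  have hValg : ∀ u : ComplexPoints T, Res[f, u, 2 * p, V] ∈ algebraicClasses (fiberOver f u) p := by
    intro u
    have h1 : Res[f, u, 2 * p, W p] ∈ algebraicClasses (fiberOver f u) p :=
      BuchweitzFlenner2003.semiregular_deforms hBF charlesSchnell_algebraicityLocus_iUnion_closed_holds Cc f hf h𝒳
        hT hTs u₀ E₀ hE₀ I hsr W hW hW₀ hp u
    rw [hVL, map_add, map_smul, map_smul] at h1
    have h2 : (a : ℂ) • Res[f, u, 2 * p, V] ∈ algebraicClasses (fiberOver f u) p := by
      have h3 := Submodule.sub_mem _ h1 (Submodule.smul_mem _ (b : ℂ) (hLalg u))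
      rwa [add_sub_cancel_right] at h3
    have h4 := Submodule.smul_mem _ (a : ℂ)⁻¹ h2
    rwa [smul_smul, inv_mul_cancel₀ ha', one_smul] at h4
  exact fun x hx => hsweep.mem_algebraicClasses hValg hx

/-- **The transfer chain with a SHEAF representative, component form** («a Buchweitz–Flenner `I`-semiregular vector
bundle at one point of the chart of a component of the locus of Hodge classes, whose Chern classes in the degrees `I` are
met by global fibrewise-Hodge classes of the chart, makes the swept class algebraic on EVERY member of the component»):
`A = C.carrier` in `forall_mem_algebraicClasses_of_sweepsClasses_sheaf`. Inputs BY NAME: `hBF` (BF Thm. 5.1, refereed named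
fact), `hsweep` (CDK chart), the tree's proof of the algebraicity-locus fact. NOT inputs: CM-ness of the point, HC_CM,
density, finiteness. [cite: BuchweitzFlenner2003, §5 Thm. 5.1, pp. 174–175] [cite: Bloch1972Semiregularity, proof of Thm. (7.4), p. 65]
[cite: CattaniDeligneKaplan1995JAMS, Thm. 1.1 and Cor. 1.2] -/
theorem hc_on_component_of_semiregular_sheaf (hBF : BuchweitzFlenner2003_variationalHodge_ISemiregular)
    (Cc : ChernCharacterBetti) (C : HodgeLocusComponent g n p)
    (hf : IsSmoothProjectiveFamily f n) (h𝒳 : IsQuasiProjectiveOver 𝒳) (hT : IsQuasiProjectiveOver T)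
    (hTs : _root_.AlgebraicGeometry.Smooth T.hom) [IrreducibleSpace T.left]
    (u₀ : ComplexPoints T) (E₀ : (fiberOver f u₀).left.Modules) (hE₀ : IsFiniteLocallyFree E₀) (I : Finset ℕ)
    (hsr : IsISemiregular hE₀ {q | q + 1 ∈ I})
    (W : (p' : ℕ) → complexBetti 𝒳 (2 * p'))
    (hW : ∀ p' ∈ I, ∀ u : ComplexPoints T,
      IsOfHodgeType n (fiberOver f u) (2 * p') p' p' (Res[f, u, 2 * p', W p']))
    (hW₀ : ∀ p' ∈ I, Res[f, u₀, 2 * p', W p'] = Cc.ch (fiberOver f u₀) E₀ p')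
    (hp : p ∈ I) (hsweep : SweepsClasses g f (W p) C.carrier) :
    ∀ x ∈ C.carrier, x.cls ∈ algebraicClasses (fiberOver g x.pt) p :=
  forall_mem_algebraicClasses_of_sweepsClasses_sheaf hBF Cc hf h𝒳 hT hTs u₀ E₀ hE₀ I hsr W hW hW₀ hp hsweep

/-- **The transfer chain with a SHEAF representative, component form, `q·hⁿ + w` shape** (`W_p = a • V + b • L`, `a ≠ 0`,
`L` fibrewise algebraic; the component is swept by `V`). [cite: BuchweitzFlenner2003, §5 Thm. 5.1, pp. 174–175]
[cite: Markman2025SecantWeil, §1.5] [cite: CattaniDeligneKaplan1995JAMS, Thm. 1.1 and Cor. 1.2] -/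
theorem hc_on_component_of_semiregular_sheaf_of_smul_add (hBF : BuchweitzFlenner2003_variationalHodge_ISemiregular)
    (Cc : ChernCharacterBetti) (C : HodgeLocusComponent g n p)
    (hf : IsSmoothProjectiveFamily f n) (h𝒳 : IsQuasiProjectiveOver 𝒳) (hT : IsQuasiProjectiveOver T)
    (hTs : _root_.AlgebraicGeometry.Smooth T.hom) [IrreducibleSpace T.left]
    (u₀ : ComplexPoints T) (E₀ : (fiberOver f u₀).left.Modules) (hE₀ : IsFiniteLocallyFree E₀) (I : Finset ℕ)
    (hsr : IsISemiregular hE₀ {q | q + 1 ∈ I})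
    (W : (p' : ℕ) → complexBetti 𝒳 (2 * p'))
    (hW : ∀ p' ∈ I, ∀ u : ComplexPoints T,
      IsOfHodgeType n (fiberOver f u) (2 * p') p' p' (Res[f, u, 2 * p', W p']))
    (hW₀ : ∀ p' ∈ I, Res[f, u₀, 2 * p', W p'] = Cc.ch (fiberOver f u₀) E₀ p')
    (hp : p ∈ I) (V L : complexBetti 𝒳 (2 * p)) (a b : ℚ) (ha : a ≠ 0)
    (hVL : W p = (a : ℂ) • V + (b : ℂ) • L)
    (hLalg : ∀ u : ComplexPoints T, Res[f, u, 2 * p, L] ∈ algebraicClasses (fiberOver f u) p)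
    (hsweep : SweepsClasses g f V C.carrier) :
    ∀ x ∈ C.carrier, x.cls ∈ algebraicClasses (fiberOver g x.pt) p :=
  forall_mem_algebraicClasses_of_sweepsClasses_sheaf_of_smul_add hBF Cc hf h𝒳 hT hTs u₀ E₀ hE₀ I hsr W hW hW₀ hp V L
    a b ha hVL hLalg hsweep

end Sheaf

end Summit.Ventures.HSemireg

end
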